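import Mathlib
import Summits.ResolutionOfSingularities.ResolutionOfSingularities.Theorems.RadicialJungCleanModelsCleanLU3ArcPackage
import Summits.ResolutionOfSingularities.ResolutionOfSingularities.Theorems.RadicialJungCleanModelsCleanLU3CdivSmall
import Summits.ResolutionOfSingularities.ResolutionOfSingularities.Theorems.RadicialJungCleanModelsCleanLUGenerises
import HarnessLib

/-!
# Route `RadicialJung`, crux `CleanModels` (stmt-15917), stub `stub_cleanLU3DefectNonDiscrete`, sub-line (C-div), piece F1-prelim:
# a residually transcendental coarsening of degree two is centred at a HEIGHT-ONE prime

Line `Sketch` rev 24 of crux stmt-ResolutionOfSingularities-15917; lead `res-B-lead-1` g4 (workfile `Lines/Sketch_Cdiv_assembly.lean` v2.1,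
piece F1-prelim).  OURS; nothing here proves resolution in characteristic `p`.

The (C-div) assembly `cleanLU3Defect_of_heightOneCoarsening_of` (`…CompositeUpstairs.lean`) wants the coarser valuation ring `O₁ ⊋ O` to BE
the local ring of the regular model at the centre of `O₁`: `locAtCentre (locAtCentre A₃ O) O₁ = O₁`.  This file derives that equality
from the geometric form of «`O₁` is divisorial»: two elements `y₁, y₂` of the model `A₃` whose residues in `κ(O₁)` are algebraically
independent over `k` (every nonzero `k`-polynomial in `y₁, y₂` is a unit of `O₁`), for a finitely generated model `A₃` of `K/k` of
dimension three, regular at the (closed) centre of `O`: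

* `eq_of_isDiscreteValuationRing_of_dominates` — a discrete valuation ring OF `K` dominated by a valuation ring is that valuation ring;
* `isRegularLocalRing_locAtCentre_of_le` — `locAtCentre A₃ O₁` is regular, a localisation of the regular `locAtCentre A₃ O` (Serre);
* `ringKrullDim_locAtCentre_le_one_of_residually_independent` — `dim locAtCentre A₃ O₁ = ht (𝔪_{O₁} ∩ A₃) ≤ 1` by the affine dimension
  formula `dim A₃/𝔮 + ht 𝔮 = dim A₃ = 3` and `dim A₃/𝔮 = trdeg_k A₃/𝔮 ≥ 2`;
* `locAtCentre_locAtCentre_eq_of_residually_independent` — hence (`O₁ ≠ K`, `Frac A₃ = K`) `locAtCentre A₃ O₁` is a discrete valuation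
  ring dominated by `O₁`, i.e. equal to it.
-/

noncomputable section

set_option linter.dupNamespace false -- mandated namespace of this single-conjunct summit

open IsLocalRing
open Literature.AlgebraicGeometry.Resolution

namespace Summit.ResolutionOfSingularities.ResolutionOfSingularities.Theorems.RadicialJung.CleanModels

variable {K : Type} [Field K] {k : Type} [Field k] [Algebra k K]

/-- **A discrete valuation ring of `K` dominated by a valuation ring of `K` is that valuation ring**: if `B ⊆ O` is a subring with
`Frac B = K` which is a discrete valuation ring, and every element of `B` invertible in `O` is invertible in `B`, then `B = O`
(the rank-free form of `locAtCentre_eq_of_DVR`, `…CleanLU3CdivSmall.lean`). [folklore] -/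
theorem eq_of_isDiscreteValuationRing_of_dominates {B : Subring K} {O : ValuationSubring K}
    [IsDiscreteValuationRing B] (hdom : SubringDominates B O.toSubring)
    (hfrac : ∀ x : K, ∃ a ∈ B, ∃ b ∈ B, b ≠ 0 ∧ x = a / b) : B = O.toSubring := by
  haveI : ValuationRing B := inferInstance
  refine le_antisymm hdom.1 fun x hxO => ?_
  by_contra hxB
  obtain ⟨a, ha, b, hb, hb0, rfl⟩ := hfrac x
  have ha0 : a ≠ 0 := by
    rintro rfl
    exact hxB (by rw [zero_div]; exact B.zero_mem)
  -- in the valuation ring `B`, `a ∣ b` or `b ∣ a`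
  obtain ⟨c, hc | hc⟩ := ValuationRing.cond (⟨a, ha⟩ : B) ⟨b, hb⟩
  · -- `a * c = b`: `(a/b)⁻¹ = c ∈ B`, and `a/b ∈ O` inverts it in `O`, so `a/b ∈ B` by domination
    have heq : a * (c : K) = b := congrArg Subtype.val hc
    have hinv : (a / b)⁻¹ ∈ B := by
      rw [inv_div, show b / a = (c : K) by rw [← heq, mul_div_cancel_left₀ _ ha0]]
      exact c.2
    have h := hdom.2 _ hinv (by rw [inv_inv]; exact hxO)
    rw [inv_inv] at h
    exact hxB h
  · -- `b * c = a`: `a/b = c ∈ B`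
    have heq : b * (c : K) = a := congrArg Subtype.val hc
    apply hxB
    rw [show a / b = (c : K) by rw [← heq, mul_div_cancel_left₀ _ hb0]]
    exact c.2

/-- **Regularity at the centre of a coarser valuation ring** (Serre: localisations of regular local rings are regular): for valuation
rings `O ≤ O₁` and a subring `B ⊆ O` with `locAtCentre B O` regular, `locAtCentre B O₁ = (locAtCentre B O)_{𝔪_{O₁} ∩ ·}` is regular.
[cite: Matsumura1987, Thm. 19.3] -/
theorem isRegularLocalRing_locAtCentre_of_le {O O₁ : ValuationSubring K} (hOO₁ : O ≤ O₁) (B : Subring K)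
    (hBO : B ≤ O.toSubring) (hreg : IsRegularLocalRing (locAtCentre B O)) :
    IsRegularLocalRing (locAtCentre B O₁) := by
  have hRO₁ : locAtCentre B O ≤ O₁.toSubring := fun z hz => hOO₁ (locAtCentre_le hBO hz)
  rw [← locAtCentre_locAtCentre_of_le hOO₁ B]
  haveI := hreg
  exact (isRegularLocalRing_locAtCentre_iff hRO₁).mpr
    (isRegularLocalRing_localization_atPrime (locAtCentre B O) _)

/-- **The centre of a residually transcendental coarsening of degree two has height `≤ 1`.**  Let `A₃` be a finitely generated
`k`-subalgebra of `K` of Krull dimension `3` inside the valuation ring `O₁`, and `y₁, y₂ ∈ A₃` such that every nonzero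
`k`-polynomial in `y₁, y₂` is a unit of `O₁`.  Then `dim (A₃)_{𝔪_{O₁} ∩ A₃} ≤ 1`: for `𝔮 = 𝔪_{O₁} ∩ A₃` the classes of `y₁, y₂` in
`A₃/𝔮 ⊆ κ(O₁)` are algebraically independent, so `dim A₃/𝔮 = trdeg_k A₃/𝔮 ≥ 2`, and `dim A₃/𝔮 + ht 𝔮 = dim A₃ = 3`.
[cite: Matsumura1987, Thm. 5.6] -/
theorem ringKrullDim_locAtCentre_le_one_of_residually_independent (A₃ : Subalgebra k K) (hfg : A₃.FG)
    {O₁ : ValuationSubring K} (hA₃O₁ : A₃.toSubring ≤ O₁.toSubring) (hdim : ringKrullDim A₃ = 3)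
    (y : Fin 2 → K) (hy : ∀ i, y i ∈ A₃)
    (hind : ∀ P : MvPolynomial (Fin 2) k, P ≠ 0 → O₁.valuation (MvPolynomial.aeval y P) = 1) :
    ringKrullDim (locAtCentre A₃.toSubring O₁) ≤ 1 := by
  classical
  letI : Algebra k A₃.toSubring := inferInstanceAs (Algebra k A₃)
  haveI : Algebra.FiniteType k A₃.toSubring := (A₃.fg_iff_finiteType.mp hfg : Algebra.FiniteType k A₃)
  haveI := isLocalization_locAtCentre (K := K) (O := O₁) hA₃O₁
  set 𝔮 := subringCentre A₃.toSubring O₁ hA₃O₁ with h𝔮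
  have h1 : ringKrullDim (locAtCentre A₃.toSubring O₁) = 𝔮.height :=
    IsLocalization.AtPrime.ringKrullDim_eq_height 𝔮 (locAtCentre A₃.toSubring O₁)
  have h2 := Literature.RingTheory.KrullDimension.ringKrullDim_quotient_add_height k (A := A₃.toSubring) 𝔮
  obtain ⟨d, hd, hd3⟩ : ∃ d : ℕ, ringKrullDim A₃.toSubring = d ∧ d = 3 := ⟨3, hdim, rfl⟩
  -- `dim (A₃ ⧸ 𝔮) ≥ 2`: the classes of `y₁, y₂` are algebraically independent over `k`
  haveI : IsDomain (A₃.toSubring ⧸ 𝔮) := Ideal.Quotient.isDomain 𝔮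
  obtain ⟨s, hs, htr⟩ :=
    Literature.RingTheory.KrullDimension.exists_ringKrullDim_eq_and_trdeg_eq k (A₃.toSubring ⧸ 𝔮)
  let y' : Fin 2 → A₃.toSubring := fun i => ⟨y i, hy i⟩
  let ι₃ : A₃.toSubring →ₐ[k] K := A₃.val
  have hind' : AlgebraicIndependent k (fun i => Ideal.Quotient.mkₐ k 𝔮 (y' i)) := by
    rw [algebraicIndependent_iff]
    intro P hP
    by_contra hP0
    rw [← MvPolynomial.comp_aeval, AlgHom.comp_apply, Ideal.Quotient.mkₐ_eq_mk,
      Ideal.Quotient.eq_zero_iff_mem] at hP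
    have hlt := (mem_subringCentre_iff hA₃O₁ _).mp hP
    have hval : ((MvPolynomial.aeval y' P : A₃.toSubring) : K) = MvPolynomial.aeval y P := by
      change ι₃ (MvPolynomial.aeval y' P) = _
      rw [← AlgHom.comp_apply, MvPolynomial.comp_aeval]
      rfl
    rw [hval, hind P hP0] at hlt
    exact lt_irrefl _ hlt
  have h2le : (2 : Cardinal) ≤ Algebra.trdeg k (A₃.toSubring ⧸ 𝔮) := by
    have h := hind'.cardinalMk_le_trdeg
    rwa [Cardinal.mk_fin] at h
  rw [htr] at h2le
  have hs2 : 2 ≤ s := by exact_mod_cast h2le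
  -- the height of `𝔮` is a natural number `n` with `s + n = d = 3`
  have hle := Ideal.height_le_ringKrullDim_of_ne_top (Ideal.IsPrime.ne_top (inferInstance : 𝔮.IsPrime))
  rw [hd] at hle
  have hle' : 𝔮.height ≤ d := by exact_mod_cast hle
  obtain ⟨n, hn⟩ := ENat.ne_top_iff_exists.1 (ne_top_of_le_ne_top (ENat.coe_ne_top d) hle')
  rw [hs, hd, ← hn] at h2
  have hsn : s + n = d := by exact_mod_cast h2
  have hn1 : n ≤ 1 := by omega
  rw [h1, ← hn]
  exact_mod_cast hn1

/-- **The height-one centre of a residually transcendental coarsening of degree two.**  Let `O ≤ O₁ ≠ K` be valuation rings of `K`,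
`A₃ ⊆ O` a finitely generated `k`-subalgebra with `Frac A₃ = K` and `dim A₃ = 3` whose local ring at the centre of `O` is regular, and
`y₁, y₂ ∈ A₃` with residues in `κ(O₁)` algebraically independent over `k` (every nonzero `k`-polynomial in them is a unit of `O₁`).
Then the local ring of `locAtCentre A₃ O` at the centre of `O₁` IS `O₁`: it is regular (Serre) of dimension `≤ 1` (height bound),
not a field (`O₁ ≠ K = Frac A₃`), hence a discrete valuation ring of `K` dominated by `O₁`. [folklore] -/
theorem locAtCentre_locAtCentre_eq_of_residually_independent {O O₁ : ValuationSubring K} (hOO₁ : O ≤ O₁)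
    (hO₁ : O₁ ≠ ⊤) (A₃ : Subalgebra k K) (hA₃O : A₃.toSubring ≤ O.toSubring) (hfg : A₃.FG)
    [IsFractionRing A₃ K] (hreg : IsRegularLocalRing (locAtCentre A₃.toSubring O))
    (hdim : ringKrullDim A₃ = 3) (y : Fin 2 → K) (hy : ∀ i, y i ∈ A₃)
    (hind : ∀ P : MvPolynomial (Fin 2) k, P ≠ 0 → O₁.valuation (MvPolynomial.aeval y P) = 1) :
    locAtCentre (locAtCentre A₃.toSubring O) O₁ = O₁.toSubring := by
  rw [locAtCentre_locAtCentre_of_le hOO₁]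
  have hA₃O₁ : A₃.toSubring ≤ O₁.toSubring := fun z hz => hOO₁ (hA₃O hz)
  haveI hregB : IsRegularLocalRing (locAtCentre A₃.toSubring O₁) :=
    isRegularLocalRing_locAtCentre_of_le hOO₁ A₃.toSubring hA₃O hreg
  have hle1 : ringKrullDim (locAtCentre A₃.toSubring O₁) ≤ 1 :=
    ringKrullDim_locAtCentre_le_one_of_residually_independent A₃ hfg hA₃O₁ hdim y hy hind
  -- every element of `K` is a fraction of elements of `A₃ ⊆ locAtCentre A₃ O₁`
  have hfrac : ∀ x : K, ∃ a ∈ locAtCentre A₃.toSubring O₁, ∃ b ∈ locAtCentre A₃.toSubring O₁,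
      b ≠ 0 ∧ x = a / b := fun x => by
    obtain ⟨a, b, hb, rfl⟩ := IsFractionRing.div_surjective (A := A₃) x
    exact ⟨a, le_locAtCentre _ O₁ a.2, b, le_locAtCentre _ O₁ b.2,
      fun h0 => nonZeroDivisors.ne_zero hb (Subtype.ext h0), rfl⟩
  -- some nonzero element of `A₃` has positive `O₁`-value (else `K = Frac A₃ ⊆ O₁`)
  obtain ⟨x, hxA, hx0, hvx⟩ : ∃ x ∈ A₃, x ≠ 0 ∧ O₁.valuation x < 1 := by
    by_contra h
    push Not at h
    apply hO₁
    refine eq_top_iff.mpr fun z _ => ?_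
    obtain ⟨a, b, hb, rfl⟩ := IsFractionRing.div_surjective (A := A₃) z
    have hb0 : ((b : A₃) : K) ≠ 0 := fun h0 => nonZeroDivisors.ne_zero hb (Subtype.ext h0)
    by_cases ha0 : ((a : A₃) : K) = 0
    · change (a : K) / (b : K) ∈ O₁
      rw [ha0, zero_div]
      exact O₁.zero_mem
    have hva : O₁.valuation (a : K) = 1 :=
      le_antisymm ((O₁.valuation_le_one_iff _).mpr (hA₃O₁ a.2)) (h _ a.2 ha0)
    have hvb : O₁.valuation (b : K) = 1 :=
      le_antisymm ((O₁.valuation_le_one_iff _).mpr (hA₃O₁ b.2)) (h _ b.2 hb0)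
    change (a : K) / (b : K) ∈ O₁
    rw [← O₁.valuation_le_one_iff, map_div₀, hva, hvb, div_one]
  -- hence the centre `𝔮` of `O₁` on `A₃` is nonzero and `dim locAtCentre A₃ O₁ = ht 𝔮 = 1`
  haveI := isLocalization_locAtCentre (K := K) (O := O₁) hA₃O₁
  set 𝔮 := subringCentre A₃.toSubring O₁ hA₃O₁ with h𝔮
  have h1 : ringKrullDim (locAtCentre A₃.toSubring O₁) = 𝔮.height :=
    IsLocalization.AtPrime.ringKrullDim_eq_height 𝔮 (locAtCentre A₃.toSubring O₁)
  have hx𝔮 : (⟨x, hxA⟩ : A₃.toSubring) ∈ 𝔮 := (mem_subringCentre_iff hA₃O₁ _).mpr hvx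
  have h𝔮0 : 𝔮.height ≠ 0 := by
    intro h0
    rw [Ideal.height_eq_zero_iff, IsDomain.minimalPrimes_eq_singleton_bot, Set.mem_singleton_iff] at h0
    rw [h0, Ideal.mem_bot] at hx𝔮
    exact hx0 (congrArg Subtype.val hx𝔮)
  have hdim1 : ringKrullDim (locAtCentre A₃.toSubring O₁) = 1 := by
    rw [h1] at hle1 ⊢
    have hle1' : 𝔮.height ≤ 1 := by exact_mod_cast hle1
    obtain ⟨n, hn⟩ := ENat.ne_top_iff_exists.1 (ne_top_of_le_ne_top (ENat.coe_ne_top 1) hle1')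
    rw [← hn] at hle1' h𝔮0 ⊢
    have hn1 : n ≤ 1 := by exact_mod_cast hle1'
    have hn0 : n ≠ 0 := fun h => h𝔮0 (by rw [h]; rfl)
    have : n = 1 := by omega
    rw [this]
    rfl
  -- a discrete valuation ring of `K` dominated by `O₁`
  haveI : IsDiscreteValuationRing (locAtCentre A₃.toSubring O₁) :=
    isDiscreteValuationRing_of_isRegularLocalRing_of_ringKrullDim_eq_one _ hdim1
  have hdom : SubringDominates (locAtCentre A₃.toSubring O₁) O₁.toSubring := by
    refine ⟨locAtCentre_le hA₃O₁, fun z hz hzinv => ?_⟩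
    by_cases hz0 : z = 0
    · rw [hz0, inv_zero]; exact Subring.zero_mem _
    refine inv_mem_locAtCentre hz (le_antisymm ((O₁.valuation_le_one_iff _).mpr (locAtCentre_le hA₃O₁ hz)) ?_)
    have h := (O₁.valuation_le_one_iff _).mpr hzinv
    rwa [map_inv₀, inv_le_one₀ ((Valuation.pos_iff _).mpr hz0)] at h
  exact eq_of_isDiscreteValuationRing_of_dominates hdom hfrac

end Summit.ResolutionOfSingularities.ResolutionOfSingularities.Theorems.RadicialJung.CleanModels

end
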